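import Summits.ValiantsHypothesis.ValiantsHypothesis.Theorems.KPlusLogSqLawValuativeDoorSectors

/-!
# LINE `valuative_door` (crux `WeakLifting`, stmt-ValiantsHypothesis-19561) — tools for the GENERAL `2 × 2` pencil on a Sidon support:
# coefficients = polarised determinants, the rank-four Gram identity, and the roof of three lines

HONEST FRAMING.  Helper (cell `pub-symmetroid`, seat val-sym-lift-p1 g23, 2026-08-29; `--supports 19561 --as helper`).  Three elementary
pieces for the width-two GENERAL (non-symmetric) valuative row on Sidon supports (sequel `…ValuativeDoorGenTwoSidon`): (1) on a Sidon support
the coefficient of `det (Σ_l X^{d_l} M_l)` (`M_l` arbitrary `2 × 2`, `…Sectors.det_pencil_two`) at `d_i + d_j`, `i ≠ j`, is the polarised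
determinant `β(M_i, M_j) = a_i δ_j + a_j δ_i − b_i c_j − b_j c_i` and at `2 d_i` it is `det M_i` (`coeff_offdiag_gen_of_sidon`,
`coeff_diag_gen_of_sidon`); (2) `β` lives on the `4`-space `M₂(F)`, so any `5 × 5` matrix `(β(M_r, N_s))_{r,s}` is singular
(`det_gram_polarDet2_eq_zero`: it factors through a `5 × 5` matrix with a zero column); (3) the ROOF of three lines
`h = min (min Λ₀ Λ₁) Λ₂` satisfies «outer ≤ inner» along equal sums (`min3_affine_outer_le_inner`, chord inequalities).  Pure algebra;
closes nothing; no bearing on vW / vB, `TropicalB`, `MatrixDescartes` (18050) or VP ≠ VNP.  [elementary]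
-/

set_option linter.dupNamespace false
set_option autoImplicit false

namespace Summit.ValiantsHypothesis.ValiantsHypothesis.Theorems.KPlusLogSqLaw.ValDoor

open Polynomial Finset Matrix
open scoped BigOperators Classical

variable {F : Type*} [Field F]

/-! ## §1 Coefficients of a general `2 × 2` pencil on a Sidon support -/

/-- the coefficient at `E` of a general `2 × 2` pencil determinant over any field: the sum of `a_l δ_{l'} − b_l c_{l'}` over ordered
pairs with `d_l + d_{l'} = E` (the `ℝ`-letter census twin is `…LacunarySymmetroidMatrixDescartes.Census.coeff_det_pencil_two`).
[bookkeeping, from `…Sectors.det_pencil_two`] -/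
theorem coeff_det_genPencil_two {K : ℕ} (d : Fin K → ℕ) (M : Fin K → Matrix (Fin 2) (Fin 2) F) (E : ℕ) :
    (Matrix.det (∑ l, ((X : F[X]) ^ d l) • (M l).map (C : F →+* F[X]))).coeff E
      = ∑ p ∈ (univ : Finset (Fin K × Fin K)).filter (fun p => d p.1 + d p.2 = E),
          (M p.1 0 0 * M p.2 1 1 - M p.1 0 1 * M p.2 1 0) := by
  rw [det_pencil_two d M, Polynomial.finsetSum_coeff]
  simp only [Polynomial.coeff_C_mul_X_pow]
  rw [Finset.sum_filter]
  refine Finset.sum_congr rfl fun p _ => ?_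
  by_cases h : d p.1 + d p.2 = E
  · rw [if_pos h, if_pos h.symm]
  · rw [if_neg h, if_neg (fun h' => h h'.symm)]

/-- on a SIDON support the off-diagonal coefficient at `d_i + d_j` of a general `2 × 2` pencil is the polarised determinant
`β(M_i, M_j) = a_i δ_j + a_j δ_i − b_i c_j − b_j c_i`. [bookkeeping] -/
theorem coeff_offdiag_gen_of_sidon {K : ℕ} (d : Fin K → ℕ) (M : Fin K → Matrix (Fin 2) (Fin 2) F)
    (hsid : ∀ l₁ l₂ l₃ l₄ : Fin K, d l₁ + d l₂ = d l₃ + d l₄ → (l₁ = l₃ ∧ l₂ = l₄) ∨ (l₁ = l₄ ∧ l₂ = l₃))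
    {i j : Fin K} (hij : i ≠ j) :
    (Matrix.det (∑ l, ((X : F[X]) ^ d l) • (M l).map (C : F →+* F[X]))).coeff (d i + d j)
      = M i 0 0 * M j 1 1 + M j 0 0 * M i 1 1 - M i 0 1 * M j 1 0 - M j 0 1 * M i 1 0 := by
  rw [coeff_det_genPencil_two d M]
  have hfilter : (univ : Finset (Fin K × Fin K)).filter (fun p => d p.1 + d p.2 = d i + d j) = {(i, j), (j, i)} := by
    ext p
    simp only [Finset.mem_filter, Finset.mem_univ, true_and, Finset.mem_insert, Finset.mem_singleton]
    constructor
    · intro h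
      rcases hsid p.1 p.2 i j h with ⟨h1, h2⟩ | ⟨h1, h2⟩
      · left; exact Prod.ext h1 h2
      · right; exact Prod.ext h1 h2
    · rintro (rfl | rfl)
      · rfl
      · exact Nat.add_comm _ _
  rw [hfilter, Finset.sum_pair (fun h => hij (Prod.mk.inj h).1)]
  ring

/-- on a Sidon support the diagonal coefficient at `2 d_i` of a general `2 × 2` pencil is `det M_i`. [bookkeeping] -/
theorem coeff_diag_gen_of_sidon {K : ℕ} (d : Fin K → ℕ) (M : Fin K → Matrix (Fin 2) (Fin 2) F)
    (hsid : ∀ l₁ l₂ l₃ l₄ : Fin K, d l₁ + d l₂ = d l₃ + d l₄ → (l₁ = l₃ ∧ l₂ = l₄) ∨ (l₁ = l₄ ∧ l₂ = l₃)) (i : Fin K) :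
    (Matrix.det (∑ l, ((X : F[X]) ^ d l) • (M l).map (C : F →+* F[X]))).coeff (d i + d i)
      = M i 0 0 * M i 1 1 - M i 0 1 * M i 1 0 := by
  rw [coeff_det_genPencil_two d M]
  have hfilter : (univ : Finset (Fin K × Fin K)).filter (fun p => d p.1 + d p.2 = d i + d i) = {(i, i)} := by
    ext p
    simp only [Finset.mem_filter, Finset.mem_univ, true_and, Finset.mem_singleton]
    constructor
    · intro h
      rcases hsid p.1 p.2 i i h with ⟨h1, h2⟩ | ⟨h1, h2⟩
      · exact Prod.ext h1 h2
      · exact Prod.ext h1 h2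
    · rintro rfl; rfl
  rw [hfilter, Finset.sum_singleton]

/-! ## §2 The rank-four Gram identity -/

/-- **five-by-five polarised-determinant matrices are singular:** for `2 × 2` letters `(a_r, b_r, c_r, δ_r)` (rows) and
`(a'_s, b'_s, c'_s, δ'_s)` (columns) the matrix `(a_r δ'_s + a'_s δ_r − b_r c'_s − b'_s c_r)_{r,s < 5}` has determinant `0` (the
polarised determinant is a bilinear form on the `4`-space `M₂`). [elementary: factor through a matrix with a zero column] -/
theorem det_gram_polarDet2_eq_zero (a b c δ a' b' c' δ' : Fin 5 → F) :
    (Matrix.of fun r s : Fin 5 => a r * δ' s + a' s * δ r - b r * c' s - b' s * c r).det = 0 := by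
  set A : Matrix (Fin 5) (Fin 5) F := Matrix.of fun r t => ![a r, b r, c r, δ r, 0] t with hA
  set B : Matrix (Fin 5) (Fin 5) F := Matrix.of fun t s => ![δ' s, -c' s, -b' s, a' s, 0] t with hB
  have hAB : (Matrix.of fun r s : Fin 5 => a r * δ' s + a' s * δ r - b r * c' s - b' s * c r) = A * B := by
    ext r s
    rw [Matrix.mul_apply, Fin.sum_univ_five]
    simp [hA, hB]
    ring
  have hdetA : A.det = 0 := Matrix.det_eq_zero_of_column_eq_zero 4 fun r => by simp [hA]
  rw [hAB, Matrix.det_mul, hdetA, zero_mul]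

/-! ## §3 The roof of three lines -/

/-- **chord inequality for the minimum of three affine functions.** [elementary] -/
theorem min3_affine_chord (p₀ q₀ p₁ q₁ p₂ q₂ A D μ : ℝ) (hμ0 : 0 ≤ μ) (hμ1 : μ ≤ 1) :
    μ * min (min (p₀ + q₀ * A) (p₁ + q₁ * A)) (p₂ + q₂ * A) + (1 - μ) * min (min (p₀ + q₀ * D) (p₁ + q₁ * D)) (p₂ + q₂ * D)
      ≤ min (min (p₀ + q₀ * (μ * A + (1 - μ) * D)) (p₁ + q₁ * (μ * A + (1 - μ) * D))) (p₂ + q₂ * (μ * A + (1 - μ) * D)) := by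
  set hA := min (min (p₀ + q₀ * A) (p₁ + q₁ * A)) (p₂ + q₂ * A) with hhA
  set hD := min (min (p₀ + q₀ * D) (p₁ + q₁ * D)) (p₂ + q₂ * D) with hhD
  have hA0 : hA ≤ p₀ + q₀ * A := (min_le_left _ _).trans (min_le_left _ _)
  have hA1 : hA ≤ p₁ + q₁ * A := (min_le_left _ _).trans (min_le_right _ _)
  have hA2 : hA ≤ p₂ + q₂ * A := min_le_right _ _
  have hD0 : hD ≤ p₀ + q₀ * D := (min_le_left _ _).trans (min_le_left _ _)
  have hD1 : hD ≤ p₁ + q₁ * D := (min_le_left _ _).trans (min_le_right _ _)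
  have hD2 : hD ≤ p₂ + q₂ * D := min_le_right _ _
  have h1μ : 0 ≤ 1 - μ := by linarith
  refine le_min (le_min ?_ ?_) ?_
  · have e : p₀ + q₀ * (μ * A + (1 - μ) * D) = μ * (p₀ + q₀ * A) + (1 - μ) * (p₀ + q₀ * D) := by ring
    rw [e]
    exact add_le_add (mul_le_mul_of_nonneg_left hA0 hμ0) (mul_le_mul_of_nonneg_left hD0 h1μ)
  · have e : p₁ + q₁ * (μ * A + (1 - μ) * D) = μ * (p₁ + q₁ * A) + (1 - μ) * (p₁ + q₁ * D) := by ring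
    rw [e]
    exact add_le_add (mul_le_mul_of_nonneg_left hA1 hμ0) (mul_le_mul_of_nonneg_left hD1 h1μ)
  · have e : p₂ + q₂ * (μ * A + (1 - μ) * D) = μ * (p₂ + q₂ * A) + (1 - μ) * (p₂ + q₂ * D) := by ring
    rw [e]
    exact add_le_add (mul_le_mul_of_nonneg_left hA2 hμ0) (mul_le_mul_of_nonneg_left hD2 h1μ)

/-- **outer ≤ inner for the roof of three lines:** `A ≤ B`, `A ≤ C`, `A + D = B + C` ⇒ `h A + h D ≤ h B + h C` for
`h t = min (min (p₀ + q₀ t) (p₁ + q₁ t)) (p₂ + q₂ t)`. [elementary: two chord inequalities] -/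
theorem min3_affine_outer_le_inner (p₀ q₀ p₁ q₁ p₂ q₂ A B Cx D : ℝ) (hAB : A ≤ B) (hAC : A ≤ Cx) (hsum : A + D = B + Cx) :
    min (min (p₀ + q₀ * A) (p₁ + q₁ * A)) (p₂ + q₂ * A) + min (min (p₀ + q₀ * D) (p₁ + q₁ * D)) (p₂ + q₂ * D)
      ≤ min (min (p₀ + q₀ * B) (p₁ + q₁ * B)) (p₂ + q₂ * B) + min (min (p₀ + q₀ * Cx) (p₁ + q₁ * Cx)) (p₂ + q₂ * Cx) := by
  rcases eq_or_lt_of_le (show A ≤ D by linarith) with hAD | hAD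
  · -- degenerate: A = B = C = D
    have hB : B = A := by linarith
    have hC : Cx = A := by linarith
    rw [hB, hC, ← hAD]
  · set μ : ℝ := (D - B) / (D - A) with hμ
    have hDA : 0 < D - A := by linarith
    have hμ0 : 0 ≤ μ := div_nonneg (by linarith) hDA.le
    have hμ1 : μ ≤ 1 := (div_le_one hDA).2 (by linarith)
    have hBμ : μ * A + (1 - μ) * D = B := by
      rw [hμ]; field_simp; ring
    have hCμ : (1 - μ) * A + (1 - (1 - μ)) * D = Cx := by
      have e : (1 - μ) * A + (1 - (1 - μ)) * D = A + D - (μ * A + (1 - μ) * D) := by ring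
      rw [e, hBμ]
      linarith
    have h1 := min3_affine_chord p₀ q₀ p₁ q₁ p₂ q₂ A D μ hμ0 hμ1
    have h2 := min3_affine_chord p₀ q₀ p₁ q₁ p₂ q₂ A D (1 - μ) (by linarith) (by linarith)
    rw [hBμ] at h1
    rw [hCμ] at h2
    linarith

end Summit.ValiantsHypothesis.ValiantsHypothesis.Theorems.KPlusLogSqLaw.ValDoor
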